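import Literature.RepresentationTheory.CompactGroups.WeylIntegrationLieFormula
import Literature.RepresentationTheory.CompactGroups.WeylIntegrationTorus
import Literature.RepresentationTheory.CompactGroups.WeylIntegrationVandermonde
import Literature.MathematicalPhysics.QuantumFieldTheory.Balaban1983to89.HaarDensityUnitaryGlobal
import Literature.MathematicalPhysics.QuantumFieldTheory.StrongCouplingActivities
import Mathlib.Analysis.CStarAlgebra.Matrix

/-!
# Weyl's integral formula for `U(n)`, file 8: THE CLASS-FUNCTION FORM
# `∫_{U(n)} F dg = (1/n!) ∫_{Δ(n)} F(t) Π_{i≠j}|t_i − t_j| dt`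

statement-level skeleton of published theorems with citation tags; proofs where landed; nothing here is a claim
about the Yang–Mills mass gap

Mega-formalization `lit-balaban` (HOME `run/shared/lean/pub/lit-balaban/`), unit `lit-balaban-p28` gen 15 (Phase-2 proof
seat, free-target protocol G.5-34(d)): FILE 8 of the discharge of the tree's named fact
`Literature.RepresentationTheory.CompactGroups.weylIntegralFormula_unitary` ([BtD] IV (1.11), `G = U(n)`): for every
measurable CLASS FUNCTION `F ≥ 0` on `U(n)` (`F(g u g⁻¹) = F(u)`),
**`∫_{U(n)} F d(Haar prob.) = ∫_{Δ(n)} w(t) F(t) d(Haar prob.)`, `w(t) = Π_i Π_{j≠i}|t_ii − t_jj| / n!`**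
(`lintegral_haarProbability_unitaryGroup_eq_lintegral_diagonalTorus`) — the printed
`|W| ∫_G f dg = ∫_T det(E − Ad_{G/T}(t⁻¹)) ∫_G f(gtg⁻¹) dg dt` with `∫_G f(gtg⁻¹) dg = f(t)` for class functions,
`|W| = n!`, `det(E − Ad(t⁻¹)) = Π_{μ≠ν}|t_μ − t_ν|`.  Assembly:
* the `U(n)` side is gen 13's GLOBAL EXPONENTIAL CHART (`HaarDensityUnitaryGlobal.lintegral_haar_unitaryGroup_eq`:
  `∫_G F = σ₀ ∫_{‖A‖<π} F(e^A)|det jac A| dA`), whose integrand is `Ad`-invariant for class functions `F`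
  (`|det jac(uAu*)| = |det jac A|`, r10's `det_jac_Adg`; `e^{uAu*} = u e^A u*`; the ball is `Ad`-invariant), so that
  file 5 (Helgason I Thm. 5.17 for `𝔲(n)`) reduces it to the slice `A = i diag θ`, `‖i diag θ‖ < π ⟺ θ ∈ (−π,π)ⁿ`,
  where `e^A = diag(e^{iθ})`, `|det jac| = Π_jΠ_k sinc((θ_j − θ_k)/2)` (gen 12) and
  `Πsinc · Π_{j≺k}(θ_j − θ_k)² = Π_{j≺k}|e^{iθ_j} − e^{iθ_k}|²` (file 6): `∫_G F = C · I(F)`,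
  `I(F) = ∫_{(−π,π]ⁿ} F(diag e^{iθ}) Π_{j≺k}|e^{iθ_j} − e^{iθ_k}|² dθ`;
* the `Δ(n)` side is file 6: `∫_T w F dt = (2π)^{−n} (n!)^{−1} I(F)`;
* `F ≡ 1` and file 7 (`I(1) = (2π)ⁿ n!`) give `C = ((2π)ⁿ n!)^{−1}`.

0 named facts, 0 sorry.  The pushforward form of the tree's fact is derived from this in file 9.

## References
* Th. Bröcker, T. tom Dieck, *Representations of Compact Lie Groups*, GTM 98 (1985), Ch. IV (1.11) p. 163 (held:
  `book:brockernd-representations-compact-lie-groups`, p0153). [BrockerTomDieck1985]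
* S. Helgason, *Groups and Geometric Analysis*, AMS Surveys 83 (2000), Ch. I §5 Thm. 5.17, Cor. 5.18, p. 195
  (held: `book:helgason2000-groups-geometric-analysis`, p0186). [Helgason2000]
-/

noncomputable section

open Complex Matrix MeasureTheory Set Real NormedSpace
open scoped ComplexConjugate ENNReal Matrix.Norms.L2Operator

namespace Literature.RepresentationTheory.CompactGroups.WeylIntegration

open Literature.MathematicalPhysics.QuantumFieldTheory.Balaban1983to89 (unitaryLogChart mem_unitaryLogChart_lie)
open Literature.MathematicalPhysics.QuantumFieldTheory.Balaban1983to89.HaarExponentialChart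
  (jacDensity jacDensity_def isChartRep_unitaryGroup lie_adStable_unitaryGroup measurable_jacDensity)
open Literature.MathematicalPhysics.QuantumFieldTheory.Balaban1983to89.B13HaarSigmaJacobian (jac Adg Adg_apply_coe det_jac_Adg)
open Literature.MathematicalPhysics.QuantumFieldTheory.Balaban1983to89.HaarDensityUnitaryGlobal
  (lintegral_haar_unitaryGroup_eq coe_expChart)
open Literature.MathematicalPhysics.QuantumFieldTheory.Balaban1983to89.HaarDensityUnitaryChart
  (jacDensity_unitaryLogChart_eq_of_roots)
open Literature.MathematicalPhysics.QuantumFieldTheory (haarProbability)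
open Literature.LinearAlgebra.Matrix (diagonalTorus)

variable {n : Type*} [Fintype n] [DecidableEq n]

/-! ## §1 The Weyl weight on `Δ(n)` and the angle integral `I(F)` -/

/-- THE WEYL WEIGHT `w(t) = Π_i Π_{j≠i} |t_ii − t_jj| / n!` on `Δ(n)` — `det(E_{G/T} − Ad_{G/T}(t⁻¹))/|W|` of (1.11)
for `G = U(n)`, exactly as in the tree's fact `weylIntegralFormula_unitary`. [cite: BrockerTomDieck1985, IV (1.11) p0153] -/
def weylWeight (t : diagonalTorus n) : ℝ≥0∞ :=
  ENNReal.ofReal ((∏ i, ∏ j ∈ Finset.univ.erase i,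
    ‖((t : Matrix.unitaryGroup n ℂ) : Matrix n n ℂ) i i - ((t : Matrix.unitaryGroup n ℂ) : Matrix n n ℂ) j j‖) /
      (Fintype.card n).factorial)

/-- `w` is measurable. [cite: BrockerTomDieck1985, IV (1.11) p0153] -/
theorem measurable_weylWeight : Measurable (weylWeight (n := n)) :=
  ENNReal.measurable_ofReal.comp (continuous_torusWeight.div_const _).measurable

/-- THE ANGLE INTEGRAL `I(F) = ∫_{(−π,π]ⁿ} F(diag e^{iθ}) Π_{j≺k}|e^{iθ_j} − e^{iθ_k}|² dθ`.
[cite: BrockerTomDieck1985, IV (1.11) p0153] -/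
def angleIntegral (F : Matrix.unitaryGroup n ℂ → ℝ≥0∞) : ℝ≥0∞ :=
  ∫⁻ θ in Set.pi Set.univ (fun _ : n => Set.Ioc (-π) π),
    F ((torusPt θ : diagonalTorus n) : Matrix.unitaryGroup n ℂ) *
      ENNReal.ofReal (∏ p : OD n, ‖cexp (θ p.1.1 * I) - cexp (θ p.1.2 * I)‖ ^ 2)

/-- `I(1) = (2π)ⁿ n!` (file 7). [cite: BrockerTomDieck1985, IV (1.11) p0153] -/
theorem angleIntegral_one : angleIntegral (n := n) (fun _ => 1) = ENNReal.ofReal (2 * π) ^ Fintype.card n * (Fintype.card n).factorial := by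
  simp only [angleIntegral, one_mul]
  exact lintegral_angleCube_prod_norm_exp_sub_sq

/-- `w(diag e^{iθ}) = Π_{j≺k}|e^{iθ_j} − e^{iθ_k}|² / n!`. [cite: BrockerTomDieck1985, IV (1.11) p0153] -/
theorem weylWeight_torusPt (θ : n → ℝ) :
    weylWeight (torusPt θ) =
      ENNReal.ofReal (∏ p : OD n, ‖cexp (θ p.1.1 * I) - cexp (θ p.1.2 * I)‖ ^ 2) / (Fintype.card n).factorial := by
  rw [weylWeight, prod_offDiag_norm_sub_torusPt, ENNReal.ofReal_div_of_pos (Nat.cast_pos.2 (Nat.factorial_pos _)),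
    ENNReal.ofReal_natCast]

/-- **THE TORUS SIDE IN ANGLES**: `∫_{Δ(n)} w F dt = (2π)^{−n} (n!)^{−1} I(F)` (file 6).
[cite: BrockerTomDieck1985, IV (1.11) p0153] [cite: BrockerTomDieck1985, I (5.13) p0045] -/
theorem lintegral_diagonalTorus_weylWeight_mul {F : Matrix.unitaryGroup n ℂ → ℝ≥0∞} (hF : Measurable F) :
    ∫⁻ t, weylWeight t * F (t : Matrix.unitaryGroup n ℂ) ∂haarProbability (diagonalTorus n) =
      (ENNReal.ofReal (2 * π) ^ Fintype.card n)⁻¹ * ((((Fintype.card n).factorial : ℝ≥0∞))⁻¹ * angleIntegral F) := by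
  have hmeas : Measurable fun t : diagonalTorus n => weylWeight t * F (t : Matrix.unitaryGroup n ℂ) :=
    measurable_weylWeight.mul (hF.comp measurable_subtype_coe)
  rw [lintegral_haarProbability_diagonalTorus_eq hmeas]
  congr 1
  simp_rw [weylWeight_torusPt]
  rw [angleIntegral, ← lintegral_const_mul' _ _ (ENNReal.inv_ne_top.2 (Nat.cast_ne_zero.2 (Nat.factorial_ne_zero _)))]
  refine lintegral_congr fun θ => ?_
  rw [div_eq_mul_inv]
  ring

/-! ## §2 The `U(n)` side: `Ad`-invariance of the exponential-chart integrand and its value on the slice -/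

/-- `𝔲(n)` is stable under `X ↦ g X g*`. [cite: Helgason2000, Ch. I §5 Thm. 5.17 p0186] -/
theorem conj_mem_unitaryLie (g : Matrix n n ℂ) {Y : Matrix n n ℂ} (hY : Y ∈ (unitaryLogChart n).lie) :
    g * Y * star g ∈ (unitaryLogChart n).lie := by
  rw [mem_unitaryLogChart_lie] at hY ⊢
  rw [star_mul, star_mul, star_star, hY]
  noncomm_ring

/-- `Ad`-stability of `𝔲(n)` under the unit `u_g` of `g ∈ U(n)`. [cite: Helgason2000, Ch. I §5 Thm. 5.17 p0186] -/
theorem hAd_unitary (g : Matrix.unitaryGroup n ℂ) : ∀ Y ∈ (unitaryLogChart n).lie,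
    ((Unitary.toUnits g : (Matrix n n ℂ)ˣ) : Matrix n n ℂ) * Y * ((Unitary.toUnits g)⁻¹ : (Matrix n n ℂ)ˣ) ∈
      (unitaryLogChart n).lie :=
  fun _ hY => conj_mem_unitaryLie (g : Matrix n n ℂ) hY

/-- `Ad`-stability of `𝔲(n)` under `u_g⁻¹`. [cite: Helgason2000, Ch. I §5 Thm. 5.17 p0186] -/
theorem hAd'_unitary (g : Matrix.unitaryGroup n ℂ) : ∀ Y ∈ (unitaryLogChart n).lie,
    (((Unitary.toUnits g)⁻¹ : (Matrix n n ℂ)ˣ) : Matrix n n ℂ) * Y * (Unitary.toUnits g : (Matrix n n ℂ)ˣ) ∈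
      (unitaryLogChart n).lie := by
  intro Y hY
  have h := conj_mem_unitaryLie (star (g : Matrix n n ℂ)) hY
  rw [star_star] at h
  exact h

/-- `toLie (Ad(g) x) = Ad_𝔤(u_g) (toLie x)` (r10's `Adg`). [cite: Helgason2000, Ch. I §5 Thm. 5.17 p0186] -/
theorem toLie_AdCoord (g : Matrix.unitaryGroup n ℂ) (x : Coord n) :
    toLie (AdCoord (g : Matrix n n ℂ) x) = Adg (hAd_unitary g) (hAd'_unitary g) (toLie x) := by
  apply Subtype.ext
  rw [coe_toLie, toMat_AdCoord, Adg_apply_coe, coe_toLie]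
  rfl

/-- **`|det jac(g X g*)| = |det jac X|`** in flat coordinates (r10's `det_jac_Adg`). [cite: Helgason2000, Ch. I §1 Thm. 1.14 (12) p. 96] -/
theorem jacDensity_toLie_AdCoord (g : Matrix.unitaryGroup n ℂ) (x : Coord n) :
    jacDensity (lie_adStable_unitaryGroup (n := n)) (toLie (AdCoord (g : Matrix n n ℂ) x)) =
      jacDensity (lie_adStable_unitaryGroup (n := n)) (toLie x) := by
  rw [jacDensity_def, jacDensity_def, toLie_AdCoord, det_jac_Adg]

/-- **`e^{gXg*} = g e^X g⁻¹`** in the chart. [cite: Helgason2000, Ch. I §5 Thm. 5.17 p0186] -/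
theorem expChart_toLie_AdCoord (g : Matrix.unitaryGroup n ℂ) (x : Coord n) :
    (isChartRep_unitaryGroup (n := n)).expChart (toLie (AdCoord (g : Matrix n n ℂ) x)) =
      g * (isChartRep_unitaryGroup (n := n)).expChart (toLie x) * g⁻¹ := by
  letI : NormedAlgebra ℚ (Matrix n n ℂ) := NormedAlgebra.restrictScalars ℚ ℂ _
  apply Subtype.ext
  rw [coe_expChart, coe_toLie, toMat_AdCoord, Matrix.UnitaryGroup.mul_val, Matrix.UnitaryGroup.mul_val,
    Matrix.UnitaryGroup.inv_val, coe_expChart, coe_toLie]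
  exact Matrix.exp_units_conj (Unitary.toUnits g) (toMat x)

/-- `‖toMat (Ad(g) x)‖ = ‖toMat x‖` (`g` unitary). [cite: Helgason2000, Ch. I §5 Thm. 5.17 p0186] -/
theorem norm_toMat_AdCoord {u : Matrix n n ℂ} (hu : u ∈ Matrix.unitaryGroup n ℂ) (x : Coord n) :
    ‖toMat (AdCoord u x)‖ = ‖toMat x‖ := by
  rw [toMat_AdCoord, CStarRing.norm_mul_mem_unitary _ (Unitary.star_mem hu), CStarRing.norm_mem_unitary_mul _ hu]

/-- `‖toLie x‖ = ‖toMat x‖`. [cite: Helgason2000, Ch. I §5 Thm. 5.17 p0186] -/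
theorem norm_toLie (x : Coord n) : ‖toLie x‖ = ‖toMat x‖ := by
  rw [← coe_toLie]; rfl

/-- On the slice: `e^{i diag θ} = diag(e^{iθ})`, i.e. `expChart (toLie (0, θ)) = torusPt θ`.
[cite: BrockerTomDieck1985, IV (3.1) p0160] -/
theorem expChart_toLie_slice (θ : n → ℝ) :
    (isChartRep_unitaryGroup (n := n)).expChart (toLie (((0 : OD n → ℂ), θ) : Coord n)) =
      ((torusPt θ : diagonalTorus n) : Matrix.unitaryGroup n ℂ) := by
  letI : NormedAlgebra ℚ (Matrix n n ℂ) := NormedAlgebra.restrictScalars ℚ ℂ _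
  apply Subtype.ext
  rw [coe_expChart, coe_toLie, toMat_zero_left, coe_torusPt, diagI, Matrix.exp_diagonal]
  congr 1
  funext j
  rw [Pi.exp_def, ← Complex.exp_eq_exp_ℂ, mul_comm]

/-- On the slice: `|det jac(i diag θ)| = Π_jΠ_k sinc((θ_j − θ_k)/2)` (gen 12). [cite: Helgason2000, Ch. I §1 Thm. 1.14 (12) p. 96] -/
theorem jacDensity_toLie_slice (θ : n → ℝ) :
    jacDensity (lie_adStable_unitaryGroup (n := n)) (toLie (((0 : OD n → ℂ), θ) : Coord n)) =
      ENNReal.ofReal (∏ j, ∏ k, Real.sinc ((θ j - θ k) / 2)) :=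
  jacDensity_unitaryLogChart_eq_of_roots _ θ (by rw [coe_toLie, toMat_zero_left]; exact roots_charpoly_diagI θ)

/-- On the slice: `‖i diag θ‖ < π ⟺ θ ∈ (−π, π)ⁿ` (operator norm of a diagonal matrix).
[cite: Helgason2000, Ch. I §5 Thm. 5.17 p0186] -/
theorem toLie_slice_mem_ball_iff (θ : n → ℝ) :
    toLie (((0 : OD n → ℂ), θ) : Coord n) ∈ Metric.ball (0 : (unitaryLogChart n).lie) π ↔
      θ ∈ Set.pi Set.univ (fun _ : n => Set.Ioo (-π) π) := by
  rw [Metric.mem_ball, dist_zero_right, norm_toLie, toMat_zero_left, diagI, Matrix.l2_opNorm_diagonal,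
    pi_norm_lt_iff Real.pi_pos, Set.mem_univ_pi]
  refine forall_congr' fun j => ?_
  rw [norm_mul, Complex.norm_I, one_mul, Complex.norm_real, Real.norm_eq_abs, Set.mem_Ioo, abs_lt]

omit [DecidableEq n] in
/-- `(−π, π)ⁿ` and `(−π, π]ⁿ` differ by a Lebesgue-null set. [cite: BrockerTomDieck1985, I (5.13) p0045] -/
theorem pi_Ioo_ae_eq_pi_Ioc :
    (Set.pi Set.univ (fun _ : n => Set.Ioo (-π) π)) =ᵐ[volume] (Set.pi Set.univ (fun _ : n => Set.Ioc (-π) π)) := by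
  rw [volume_pi]
  exact (Measure.univ_pi_Ioo_ae_eq_Icc (f := fun _ : n => -π) (g := fun _ => π)).trans
    (Measure.univ_pi_Ioc_ae_eq_Icc (f := fun _ : n => -π) (g := fun _ => π)).symm

/-! ## §3 The class-function form of Weyl's integral formula -/

/-- THE EXPONENTIAL-CHART INTEGRAND in flat coordinates: `Ψ_F(x) = 1_{‖x‖<π} F(e^{X(x)}) |det jac X(x)|`.
[cite: Helgason2000, Ch. I §1 Thm. 1.14 (13) p. 96] -/
def chartIntegrand (F : Matrix.unitaryGroup n ℂ → ℝ≥0∞) : Coord n → ℝ≥0∞ :=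
  (toLie ⁻¹' Metric.ball (0 : (unitaryLogChart n).lie) π).indicator fun x =>
    F ((isChartRep_unitaryGroup (n := n)).expChart (toLie x)) * jacDensity (lie_adStable_unitaryGroup (n := n)) (toLie x)

/-- **`Ψ_F` is `Ad(U(n))`-invariant for class functions `F`.** [cite: Helgason2000, Ch. I §5 Thm. 5.17 p0186] -/
theorem chartIntegrand_AdCoord {F : Matrix.unitaryGroup n ℂ → ℝ≥0∞} (hcl : ∀ g u : Matrix.unitaryGroup n ℂ, F (g * u * g⁻¹) = F u)
    (u : Matrix n n ℂ) (hu : u ∈ Matrix.unitaryGroup n ℂ) (x : Coord n) :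
    chartIntegrand F (AdCoord u x) = chartIntegrand F x := by
  have hmem : AdCoord u x ∈ toLie ⁻¹' Metric.ball (0 : (unitaryLogChart n).lie) π ↔
      x ∈ toLie ⁻¹' Metric.ball (0 : (unitaryLogChart n).lie) π := by
    simp only [Set.mem_preimage, Metric.mem_ball, dist_zero_right, norm_toLie, norm_toMat_AdCoord hu]
  by_cases hx : x ∈ toLie ⁻¹' Metric.ball (0 : (unitaryLogChart n).lie) π
  · rw [chartIntegrand, Set.indicator_of_mem (hmem.2 hx), Set.indicator_of_mem hx]
    have h1 := expChart_toLie_AdCoord ⟨u, hu⟩ x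
    have h2 := jacDensity_toLie_AdCoord ⟨u, hu⟩ x
    simp only at h1 h2
    rw [h1, h2, hcl]
  · rw [chartIntegrand, Set.indicator_of_notMem (mt hmem.1 hx), Set.indicator_of_notMem hx]

/-- **`Ψ_F` on the slice, integrated against `Π(θ_j − θ_k)²`, is the angle integral `I(F)`.**
[cite: Helgason2000, Ch. I §5 Thm. 5.17 p0186] [cite: BrockerTomDieck1985, IV (1.11) p0153] -/
theorem lintegral_chartIntegrand_slice {F : Matrix.unitaryGroup n ℂ → ℝ≥0∞} :
    ∫⁻ θ : n → ℝ, chartIntegrand F (((0 : OD n → ℂ), θ) : Coord n) *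
        ENNReal.ofReal (∏ p : OD n, (θ p.1.1 - θ p.1.2) ^ 2) = angleIntegral F := by
  have hpt : ∀ θ : n → ℝ, chartIntegrand F (((0 : OD n → ℂ), θ) : Coord n) *
      ENNReal.ofReal (∏ p : OD n, (θ p.1.1 - θ p.1.2) ^ 2) =
      (Set.pi Set.univ (fun _ : n => Set.Ioo (-π) π)).indicator (fun θ =>
        F ((torusPt θ : diagonalTorus n) : Matrix.unitaryGroup n ℂ) *
          ENNReal.ofReal (∏ p : OD n, ‖cexp (θ p.1.1 * I) - cexp (θ p.1.2 * I)‖ ^ 2)) θ := by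
    intro θ
    by_cases hθ : θ ∈ Set.pi Set.univ (fun _ : n => Set.Ioo (-π) π)
    · rw [chartIntegrand, Set.indicator_of_mem (show (((0 : OD n → ℂ), θ) : Coord n) ∈ _ from (toLie_slice_mem_ball_iff θ).2 hθ),
        Set.indicator_of_mem hθ, expChart_toLie_slice, jacDensity_toLie_slice, mul_assoc,
        ← ENNReal.ofReal_mul' (Finset.prod_nonneg fun p _ => sq_nonneg _), prod_sinc_mul_prod_sub_sq]
    · rw [chartIntegrand, Set.indicator_of_notMem (show (((0 : OD n → ℂ), θ) : Coord n) ∉ _ from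
        fun h => hθ ((toLie_slice_mem_ball_iff θ).1 h)), Set.indicator_of_notMem hθ, zero_mul]
  simp_rw [hpt]
  rw [lintegral_indicator (MeasurableSet.univ_pi fun _ => measurableSet_Ioo), angleIntegral]
  exact setLIntegral_congr pi_Ioo_ae_eq_pi_Ioc

section ClassFunction

variable [MeasurableSpace (unitaryLogChart n).lie] [BorelSpace (unitaryLogChart n).lie]

/-- `Ψ_F` is measurable (for the Borel structure of `𝔲(n)`). [cite: Helgason2000, Ch. I §1 Thm. 1.14 (13) p. 96] -/
theorem measurable_chartIntegrand {F : Matrix.unitaryGroup n ℂ → ℝ≥0∞} (hF : Measurable F) :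
    Measurable (chartIntegrand (n := n) F) := by
  have ht : Measurable (toLie (n := n) : Coord n → (unitaryLogChart n).lie) := (toLie (n := n)).continuous.measurable
  refine Measurable.indicator ?_ (measurableSet_ball.preimage ht)
  exact ((hF.comp (isChartRep_unitaryGroup (n := n)).measurable_expChart).mul (measurable_jacDensity _)).comp ht

end ClassFunction

/-- **`∫_{U(n)} F = C · I(F)` with ONE constant `C` for all measurable class functions `F ≥ 0`** (gen 13's global chart +
file 5's Lie-algebra formula). [cite: Helgason2000, Ch. I §5 Thm. 5.17 p0186] [cite: BrockerTomDieck1985, IV (1.11) p0153] -/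
theorem exists_const_lintegral_unitaryGroup_eq_angleIntegral :
    ∃ C : ℝ≥0∞, ∀ F : Matrix.unitaryGroup n ℂ → ℝ≥0∞, Measurable F →
      (∀ g u : Matrix.unitaryGroup n ℂ, F (g * u * g⁻¹) = F u) →
      ∫⁻ u, F u ∂haarProbability (Matrix.unitaryGroup n ℂ) = C * angleIntegral F := by
  letI : MeasurableSpace (unitaryLogChart n).lie := borel _
  haveI : BorelSpace (unitaryLogChart n).lie := ⟨rfl⟩
  have ht : Measurable (toLie (n := n) : Coord n → (unitaryLogChart n).lie) := (toLie (n := n)).continuous.measurable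
  set η : Measure (unitaryLogChart n).lie := Measure.map (toLie (n := n)) volume with hη
  haveI : η.IsAddHaarMeasure := (toLie (n := n)).isAddHaarMeasure_map volume
  obtain ⟨c, -, -, hc⟩ := exists_const_lintegral_eq_lintegral_slice (n := n) (haarProbability (Matrix.unitaryGroup n ℂ))
  refine ⟨(haarProbability (Matrix.unitaryGroup n ℂ) Set.univ /
      ∫⁻ X in Metric.ball 0 Real.pi, jacDensity (lie_adStable_unitaryGroup (n := n)) X ∂η) * c, fun F hF hcl => ?_⟩
  rw [lintegral_haar_unitaryGroup_eq η (haarProbability (Matrix.unitaryGroup n ℂ)) hF, mul_assoc]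
  congr 1
  have hGm : Measurable fun X : (unitaryLogChart n).lie =>
      F ((isChartRep_unitaryGroup (n := n)).expChart X) * jacDensity (lie_adStable_unitaryGroup (n := n)) X :=
    (hF.comp (isChartRep_unitaryGroup (n := n)).measurable_expChart).mul (measurable_jacDensity _)
  have h1 : ∫⁻ X in Metric.ball 0 Real.pi, F ((isChartRep_unitaryGroup (n := n)).expChart X) *
      jacDensity (lie_adStable_unitaryGroup (n := n)) X ∂η = ∫⁻ x, chartIntegrand F x := by
    rw [hη, setLIntegral_map measurableSet_ball hGm ht, ← lintegral_indicator (measurableSet_ball.preimage ht)]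
    rfl
  rw [h1, hc (chartIntegrand F) (measurable_chartIntegrand hF) (fun u hu x => chartIntegrand_AdCoord hcl u hu x),
    lintegral_chartIntegrand_slice]

/-- `∫_{U(n)} F = ((2π)ⁿ n!)⁻¹ · I(F)` for measurable class functions `F ≥ 0` (the constant fixed by `F ≡ 1`, file 7).
[cite: BrockerTomDieck1985, IV (1.11) p0153] -/
theorem lintegral_unitaryGroup_eq_angleIntegral {F : Matrix.unitaryGroup n ℂ → ℝ≥0∞} (hF : Measurable F)
    (hcl : ∀ g u : Matrix.unitaryGroup n ℂ, F (g * u * g⁻¹) = F u) :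
    ∫⁻ u, F u ∂haarProbability (Matrix.unitaryGroup n ℂ) =
      (ENNReal.ofReal (2 * π) ^ Fintype.card n * (Fintype.card n).factorial)⁻¹ * angleIntegral F := by
  obtain ⟨C, hC⟩ := exists_const_lintegral_unitaryGroup_eq_angleIntegral (n := n)
  have h1 := hC (fun _ => 1) measurable_const (fun _ _ => rfl)
  rw [lintegral_const, measure_univ, mul_one, angleIntegral_one] at h1
  rw [hC F hF hcl, ENNReal.eq_inv_of_mul_eq_one_left h1.symm]

/-- **WEYL'S INTEGRAL FORMULA FOR `U(n)`, CLASS-FUNCTION FORM**: for every measurable class function `F ≥ 0` on `U(n)`,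
`∫_{U(n)} F d(Haar prob.) = ∫_{Δ(n)} (Π_i Π_{j≠i}|t_ii − t_jj| / n!) F(t) d(Haar prob.)` — the printed
`|W| ∫_G f = ∫_T det(E − Ad_{G/T}(t⁻¹)) (∫_G f(gtg⁻¹) dg) dt` for `G = U(n)`, `T = Δ(n)`, `|W| = n!`, with
`∫_G f(gtg⁻¹) dg = f(t)` for a class function. [cite: BrockerTomDieck1985, IV (1.11) p0153] -/
theorem lintegral_haarProbability_unitaryGroup_eq_lintegral_diagonalTorus {F : Matrix.unitaryGroup n ℂ → ℝ≥0∞}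
    (hF : Measurable F) (hcl : ∀ g u : Matrix.unitaryGroup n ℂ, F (g * u * g⁻¹) = F u) :
    ∫⁻ u, F u ∂haarProbability (Matrix.unitaryGroup n ℂ) =
      ∫⁻ t, weylWeight t * F (t : Matrix.unitaryGroup n ℂ) ∂haarProbability (diagonalTorus n) := by
  rw [lintegral_unitaryGroup_eq_angleIntegral hF hcl, lintegral_diagonalTorus_weylWeight_mul hF, ← mul_assoc,
    ENNReal.mul_inv (Or.inr (ENNReal.natCast_ne_top _)) (Or.inl (ENNReal.pow_ne_top ENNReal.ofReal_ne_top))]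

end Literature.RepresentationTheory.CompactGroups.WeylIntegration
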